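import Summits.BirchSwinnertonDyer.BirchSwinnertonDyer.Theorems.GenusKolyvaginAtTwoGenusPrimitiveSupplyAtTwoGenusReduction
import Literature.NumberTheory.EllipticCurves.RingClassGenusCharacter
import Literature.NumberTheory.EllipticCurves.RingClassGenusCharacterProofs
import Summits.BirchSwinnertonDyer.Uniform.U2.RingClassNoTwoTorsion
import Literature.NumberTheory.EllipticCurves.SelmerTrivialCorankProofs
import Literature.NumberTheory.EllipticCurves.NonEisensteinPrimeOfSurjective
import Literature.NumberTheory.EllipticCurves.KolyvaginShaStructureIndexFormProofs
import Literature.NumberTheory.QuadraticFields.FundamentalDiscriminant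

/-!
# Route `GenusKolyvaginAtTwo`, crux `GenusPrimitiveSupplyAtTwo` (stmt-BirchSwinnertonDyer-22136), line `genus-supply`:
# `P(ℓ) ≡ Y_θ (mod 2E(K[ℓ]))` — the derived point at a Kolyvagin prime at `2` is the Heegner point over the GENUS FIELD
# `K(√ℓ*)`, independently of the coset representatives

Sequel of `…GenusReduction.lean` (prime level: `P(ℓ) ∈ 2E(K[ℓ]) ⟺` the «even half» `Σ_{s∈S, i even} (sσ^i)·y(ℓ) ∈
2E(K[ℓ])`, which still mentions the representatives `S`). Here the even half is replaced by an INTRINSIC point. Let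
`θ = √ℓ* ∈ K[ℓ]` (`θ² ∈ ℚ`, `θ ≠ 0`; class field theory of the genus character of conductor `ℓ` — the tree's named fact
`sqrt_pStar_mem_ringClassField`, entering here only through the HYPOTHESES `hθ2`, `hθ0`, `hflip`: some element of
`G_ℓ = Gal(K[ℓ]/K[1])` moves `θ`). Then the generator `σ_ℓ` moves `θ` to `−θ`, every `g ∈ Aut_ℚ(K[ℓ])` moves `θ` to `±θ`
(Silverman X.2, tree `algEquiv_apply_eq_or_eq_neg_of_sq_eq`), so on the coset `s·G_ℓ` the elements FIXING `θ` are the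
`sσ^i` with `i` even if `sθ = θ` and with `i` odd if `sθ = −θ`; as the coset trace `s·Tr_{G_ℓ} y(ℓ) = a_ℓ · s y(1)` is in
`2E(K[ℓ])` (Gross Prop. 3.7 (1); `2 ∣ a_ℓ`), the odd part, the even part and the `θ`-fixed part of each coset agree
modulo `2E(K[ℓ])`. Summing over `S` (`S·G_ℓ = 𝒢_ℓ = Gal(K[ℓ]/K)`):
  `P(ℓ) ∈ 2E(K[ℓ]) ⟺ Y_θ := Σ_{g ∈ Gal(K[ℓ]/K), gθ = θ} g·y(ℓ) ∈ 2E(K[ℓ])`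
(`heegner_exists_two_zsmul_eq_derivedPoint_iff_genusTrace`), where `Y_θ = Tr_{K[ℓ]/K(θ)} y(ℓ) ∈ E(K(√ℓ*))` is the Heegner
point of conductor `ℓ` traced to the genus field `ℚ(√d_K, √ℓ*)` — the Gross–Zagier datum of the twist pair
`(E^{(ℓ*)}, E^{(d_K ℓ*)})` of the route's rationale, now WITHOUT reference to `S`, `σ_ℓ` or `D_ℓ`.
* §1 (abstract): `sum_filter_fix_eq`, `exists_sum_odd_eq_sum_fix_add`, `exists_oddHalf_eq_fixPart_add`.
* §2 (Heegner): `heegner_sigma_apply_theta` (`σ_ℓ θ = −θ`), `heegner_pow_sigma_apply_theta`, `heegner_fix_mul_pow_iff`,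
  `heegner_mem_image_mul_pow_iff` (`S·G_ℓ = 𝒢_ℓ`), `heegner_exists_two_zsmul_eq_derivedPoint_iff_fixPart`,
  `heegner_exists_two_zsmul_eq_derivedPoint_iff_genusTrace`.
* §3–§5 (APPENDS): `heegner_exists_theta_derivedPoint_iff_genusTrace[_holds]` (θ from `sqrt_pStar_mem_ringClassField`,
  §5 UNCONDITIONAL via the tree theorem `…_holds`); `heegner_two_torsion_free` (`E(K[n])[2] = 0`, U2's
  `forall_two_nsmul_eq_zero_of_heegner`); `heegner_exists_two_zsmul_eq_derivedPoint_iff_four_dvd` (`P(ℓ) ∈ 2E ⟺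
  a_ℓ y_K′ − Y_χ ∈ 4E(K[ℓ])`, unconditional).
Helper for the crux item (`--supports stmt-BirchSwinnertonDyer-22136`, helper mode). No summit and no leaf is proved
by this file; BSD is not proved by any of this.
-/

set_option linter.dupNamespace false -- tree convention: `Summit.BirchSwinnertonDyer.BirchSwinnertonDyer.Theorems` (summit = sub-problem)

noncomputable section

open scoped Classical

namespace Summit.BirchSwinnertonDyer.BirchSwinnertonDyer.Theorems.GenusKoly

open Finset NumberField WeierstrassCurve Literature.NumberTheory.EllipticCurves
  Literature.NumberTheory.EllipticCurves.ModularForms Literature.NumberTheory.EllipticCurves.KolyvaginOperator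

/-! ## §1 The `θ`-fixed part of a coset, abstractly -/

section Operator

variable {G : Type*} [Monoid G] {A : Type*} [AddCommGroup A] (ρ : G →* AddMonoid.End A)

/-- On a coset `s·⟨σ⟩`: if `p(sσ^i) ↔ (p(s) ↔ i even)` (a sign character with `p(σ)` false), the `p`-part of the coset sum
is its even part when `p(s)` and its odd part otherwise. [folklore] -/
theorem sum_filter_fix_eq (σ s : G) (ℓ : ℕ) (y : A) (p : G → Prop) (hpar : ∀ i, p (s * σ ^ i) ↔ (p s ↔ Even i)) :
    ∑ i ∈ (range (ℓ + 1)).filter (fun i ↦ p (s * σ ^ i)), ρ (s * σ ^ i) y =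
      if p s then ∑ i ∈ (range (ℓ + 1)).filter (fun i ↦ ¬ Odd i), ρ (s * σ ^ i) y
      else ∑ i ∈ (range (ℓ + 1)).filter Odd, ρ (s * σ ^ i) y := by
  split_ifs with hs
  · refine Finset.sum_congr (Finset.filter_congr fun i _ ↦ ?_) fun _ _ ↦ rfl
    rw [hpar i, Nat.not_odd_iff_even]
    exact ⟨fun h ↦ h.mp hs, fun h ↦ ⟨fun _ ↦ h, fun _ ↦ hs⟩⟩
  · refine Finset.sum_congr (Finset.filter_congr fun i _ ↦ ?_) fun _ _ ↦ rfl
    rw [hpar i, ← Nat.not_even_iff_odd]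
    exact ⟨fun h he ↦ hs (h.mpr he), fun h ↦ ⟨fun hps ↦ absurd hps hs, fun he ↦ absurd he h⟩⟩

/-- On a coset whose trace `Σ_{i≤ℓ} (sσ^i)·y` lies in `2A`: odd part ≡ `p`-part (mod `2A`). [folklore] -/
theorem exists_sum_odd_eq_sum_fix_add (σ s : G) (ℓ : ℕ) (y : A) (p : G → Prop)
    (hpar : ∀ i, p (s * σ ^ i) ↔ (p s ↔ Even i))
    (htr : ∃ w : A, (2 : ℤ) • w = ∑ i ∈ range (ℓ + 1), ρ (s * σ ^ i) y) :
    ∃ z : A, ∑ i ∈ (range (ℓ + 1)).filter Odd, ρ (s * σ ^ i) y =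
      ∑ i ∈ (range (ℓ + 1)).filter (fun i ↦ p (s * σ ^ i)), ρ (s * σ ^ i) y + (2 : ℤ) • z := by
  rw [sum_filter_fix_eq ρ σ s ℓ y p hpar]
  obtain ⟨w, hw⟩ := htr
  have hsplit := Finset.sum_filter_add_sum_filter_not (range (ℓ + 1)) Odd (fun i ↦ ρ (s * σ ^ i) y)
  split_ifs with hs
  · refine ⟨w - ∑ i ∈ (range (ℓ + 1)).filter (fun i ↦ ¬ Odd i), ρ (s * σ ^ i) y, ?_⟩
    rw [← hw] at hsplit
    linear_combination (norm := module) hsplit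
  · exact ⟨0, by rw [smul_zero, add_zero]⟩

/-- **Odd half ≡ `p`-part of `S·⟨σ⟩` (mod 2A)**, summed over the representatives and reindexed through the injective
`(s, i) ↦ sσ^i`. [folklore] -/
theorem exists_oddHalf_eq_fixPart_add (σ : G) (S : Finset G) (ℓ : ℕ) (y : A) (p : G → Prop)
    (hpar : ∀ s ∈ S, ∀ i, p (s * σ ^ i) ↔ (p s ↔ Even i))
    (htr : ∀ s ∈ S, ∃ w : A, (2 : ℤ) • w = ∑ i ∈ range (ℓ + 1), ρ (s * σ ^ i) y)
    (hinj : Set.InjOn (fun q : G × ℕ ↦ q.1 * σ ^ q.2) (S ×ˢ range (ℓ + 1) : Finset (G × ℕ))) :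
    ∃ z : A, ∑ s ∈ S, ρ s (∑ i ∈ (range (ℓ + 1)).filter Odd, ρ (σ ^ i) y) =
      ∑ g ∈ ((S ×ˢ range (ℓ + 1)).image (fun q : G × ℕ ↦ q.1 * σ ^ q.2)).filter p, ρ g y + (2 : ℤ) • z := by
  have key : ∀ s ∈ S, ∃ z : A, ρ s (∑ i ∈ (range (ℓ + 1)).filter Odd, ρ (σ ^ i) y) =
      ∑ i ∈ (range (ℓ + 1)).filter (fun i ↦ p (s * σ ^ i)), ρ (s * σ ^ i) y + (2 : ℤ) • z := by
    intro s hs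
    have hre : ρ s (∑ i ∈ (range (ℓ + 1)).filter Odd, ρ (σ ^ i) y) =
        ∑ i ∈ (range (ℓ + 1)).filter Odd, ρ (s * σ ^ i) y := by
      rw [map_sum]
      exact Finset.sum_congr rfl fun i _ ↦ by rw [map_mul]; rfl
    rw [hre]
    exact exists_sum_odd_eq_sum_fix_add ρ σ s ℓ y p (hpar s hs) (htr s hs)
  choose! z hz using key
  refine ⟨∑ s ∈ S, z s, ?_⟩
  rw [Finset.sum_congr rfl hz, Finset.sum_add_distrib, ← Finset.smul_sum]
  congr 1
  rw [Finset.sum_filter, Finset.sum_image hinj, Finset.sum_product]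
  refine Finset.sum_congr rfl fun s _ ↦ ?_
  rw [Finset.sum_filter]

end Operator

/-! ## §2 The genus datum `θ = √ℓ*` on the tree's Heegner data of prime conductor -/

section Heegner

variable {W : WeierstrassCurve ℚ} [NeZero (W.conductorNorm ℤ)] {K : Type} [Field K] [NumberField K]
  {Dt : ModularParametrizationData W (W.conductorNorm ℤ)} {β : ℤ} {ι : K →+* ℂ}

/-- **The generator `σ_ℓ` moves `θ` to `−θ`**: `G_ℓ = ⟨σ_ℓ⟩`, some element of `G_ℓ` moves `θ` (the genus character of
conductor `ℓ` is non-trivial on `G_ℓ`: clause (2) of `sqrt_pStar_mem_ringClassField`), and each automorphism moves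
`θ` to `±θ`. [cite: SilvermanAEC2009, X.2 Prop. 2.4 (proof)] [cite: Cox2013, §9.A and Thm. 8.10] -/
theorem heegner_sigma_apply_theta (hK : IsImaginaryQuadratic K) (hD : NumberField.discr K < -4) {ℓ : ℕ}
    (hℓ : ℓ.Prime) (hinert : (Ideal.span {(ℓ : 𝓞 K)}).IsPrime) (d : KolyvaginHeegnerData Dt β ι ℓ)
    {θ : ringClassField K ι ℓ} {q : ℚ} (hθ2 : θ ^ 2 = algebraMap ℚ (ringClassField K ι ℓ) q) (hθ0 : θ ≠ 0)
    (hflip : ∃ τ ∈ ringClassGalOver ι ℓ 1, τ θ = -θ) : d.σ ℓ θ = -θ := by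
  rcases algEquiv_apply_eq_or_eq_neg_of_sq_eq hθ2 (d.σ ℓ) with h | h
  · exfalso
    obtain ⟨τ, hτ, hτθ⟩ := hflip
    have hτ' : τ ∈ (ringClassGalOver ι ℓ 1 : Set _) := hτ
    rw [heegner_coe_ringClassGalOver_eq_image_pow hK hD hℓ hinert d, Finset.mem_coe, Finset.mem_image] at hτ'
    obtain ⟨i, -, rfl⟩ := hτ'
    have hfix : ∀ j : ℕ, (d.σ ℓ ^ j) θ = θ := fun j ↦ by
      induction j with
      | zero => rfl
      | succ j ih => rw [pow_succ, AlgEquiv.mul_apply, h, ih]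
    exact ne_neg_of_ne_zero hθ0 ((hfix i).symm.trans hτθ)
  · exact h

/-- `σ_ℓ^i θ = θ` for even `i` and `= −θ` for odd `i`. [cite: SilvermanAEC2009, X.2 Prop. 2.4 (proof)] -/
theorem heegner_pow_sigma_apply_theta {ℓ : ℕ} (d : KolyvaginHeegnerData Dt β ι ℓ) {θ : ringClassField K ι ℓ}
    (hσ : d.σ ℓ θ = -θ) (i : ℕ) : (d.σ ℓ ^ i) θ = if Even i then θ else -θ := by
  induction i with
  | zero => simp
  | succ i ih =>
    rw [pow_succ, AlgEquiv.mul_apply, hσ, map_neg, ih]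
    by_cases hi : Even i
    · have : ¬ Even (i + 1) := Nat.not_even_iff_odd.mpr (Even.add_one hi)
      simp [hi, this]
    · have : Even (i + 1) := by
        rw [Nat.not_even_iff_odd] at hi
        exact hi.add_one
      simp [hi, this]

/-- **The `θ`-fixed elements of the coset `s·G_ℓ`**: `sσ^i θ = θ ↔ (sθ = θ ↔ i even)` (each automorphism moves `θ` to
`±θ`, `σ_ℓ` moves it to `−θ`, `θ ≠ −θ`). [cite: SilvermanAEC2009, X.2 Prop. 2.4 (proof)] -/
theorem heegner_fix_mul_pow_iff {ℓ : ℕ} (d : KolyvaginHeegnerData Dt β ι ℓ) {θ : ringClassField K ι ℓ} {q : ℚ}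
    (hθ2 : θ ^ 2 = algebraMap ℚ (ringClassField K ι ℓ) q) (hθ0 : θ ≠ 0) (hσ : d.σ ℓ θ = -θ)
    (s : ringClassField K ι ℓ ≃ₐ[ℚ] ringClassField K ι ℓ) (i : ℕ) :
    (s * d.σ ℓ ^ i) θ = θ ↔ (s θ = θ ↔ Even i) := by
  have hne : θ ≠ -θ := ne_neg_of_ne_zero hθ0
  have hne' : -θ ≠ θ := fun h ↦ hne h.symm
  rw [AlgEquiv.mul_apply, heegner_pow_sigma_apply_theta d hσ i]
  rcases algEquiv_apply_eq_or_eq_neg_of_sq_eq hθ2 s with hs | hs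
  · by_cases hi : Even i
    · simp [hi, hs]
    · simp [hi, hs, map_neg, hne']
  · by_cases hi : Even i
    · simp [hi, hs, hne']
    · simp [hi, hs, map_neg, hne']

/-- **`S·G_ℓ = 𝒢_ℓ`**: the elements `sσ_ℓ^i` (`s ∈ S`, `i ≤ ℓ`) are exactly the elements of `Gal(K[ℓ]/K)` (`S` a
transversal of `𝒢_ℓ/G_ℓ`, `G_ℓ = {σ_ℓ^i : i ≤ ℓ}`). [cite: GrossLMS1991, §3–§4 (S, 𝒢_n, G_n)] -/
theorem heegner_mem_image_mul_pow_iff (hK : IsImaginaryQuadratic K) (hD : NumberField.discr K < -4) {ℓ : ℕ}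
    (hℓ : ℓ.Prime) (hinert : (Ideal.span {(ℓ : 𝓞 K)}).IsPrime) (d : KolyvaginHeegnerData Dt β ι ℓ)
    (g : ringClassField K ι ℓ ≃ₐ[ℚ] ringClassField K ι ℓ) :
    g ∈ (d.S ×ˢ range (ℓ + 1)).image
        (fun q : (ringClassField K ι ℓ ≃ₐ[ℚ] ringClassField K ι ℓ) × ℕ ↦ q.1 * d.σ ℓ ^ q.2) ↔
      g ∈ ringClassGal ι ℓ := by
  have hG := heegner_coe_ringClassGalOver_eq_image_pow hK hD hℓ hinert d
  constructor
  · intro hg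
    rw [Finset.mem_image] at hg
    obtain ⟨⟨s, i⟩, hsi, rfl⟩ := hg
    rw [Finset.mem_product] at hsi
    exact Subgroup.mul_mem _ (d.S_subset s hsi.1)
      (ringClassGalOver_le_ringClassGal ι ℓ 1 (heegner_sigma_pow_mem hℓ d i))
  · intro hg
    obtain ⟨t, ⟨htS, ht⟩, -⟩ := d.S_transversal g hg
    -- `t⁻¹ g ∈ G_ℓ`, so `t⁻¹ g = σ^i` with `i ≤ ℓ`
    have hmem : t⁻¹ * g ∈ (ringClassGalOver ι ℓ 1 : Set _) := by
      have := Subgroup.inv_mem _ ht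
      rwa [mul_inv_rev, inv_inv] at this
    rw [hG, Finset.mem_coe, Finset.mem_image] at hmem
    obtain ⟨i, hi, hti⟩ := hmem
    rw [Finset.mem_image]
    refine ⟨⟨t, i⟩, Finset.mem_product.mpr ⟨htS, hi⟩, ?_⟩
    simp only
    rw [hti, mul_inv_cancel_left]

/-- **`P(ℓ) ∈ 2E(K[ℓ]) ⟺` the `θ`-FIXED part of `𝒢_ℓ·y(ℓ)` is in `2E(K[ℓ])`** (representatives form): for `E/ℚ` (globally
minimal `W`), `K` imaginary quadratic with the Heegner hypothesis and `d_K < −4`, `ℓ ∤ N_E` a prime inert in `K` with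
`2 ∣ a_ℓ`, a datum `d` of conductor `ℓ`, and `θ ∈ K[ℓ]`, `θ² ∈ ℚ`, `θ ≠ 0`, moved by some element of `G_ℓ`.
[cite: GrossLMS1991, §3 (3.3), (3.5), Prop. 3.7 (1), §4 (4.1)] [cite: SilvermanAEC2009, X.2 Prop. 2.4 (proof)] -/
theorem heegner_exists_two_zsmul_eq_derivedPoint_iff_fixPart [W.IsElliptic] [W.IsGloballyMinimal]
    (hK : IsImaginaryQuadratic K) (hD : NumberField.discr K < -4)
    (hH : SatisfiesHeegnerHypothesis (W.conductorNorm ℤ) K) {ℓ : ℕ} (hℓ : ℓ.Prime)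
    (hinert : (Ideal.span {(ℓ : 𝓞 K)}).IsPrime) (hℓN : ¬ ℓ ∣ W.conductorNorm ℤ)
    (ha : (2 : ℤ) ∣ W.frobeniusTrace ℓ) (d : KolyvaginHeegnerData Dt β ι ℓ)
    {θ : ringClassField K ι ℓ} {q : ℚ} (hθ2 : θ ^ 2 = algebraMap ℚ (ringClassField K ι ℓ) q) (hθ0 : θ ≠ 0)
    (hflip : ∃ τ ∈ ringClassGalOver ι ℓ 1, τ θ = -θ) :
    (∃ Q : (W.baseChange (ringClassField K ι ℓ)).toAffine.Point, (2 : ℤ) • Q = d.derivedPoint) ↔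
      ∃ Q : (W.baseChange (ringClassField K ι ℓ)).toAffine.Point, (2 : ℤ) • Q =
        ∑ g ∈ ((d.S ×ˢ range (ℓ + 1)).image
            (fun q : (ringClassField K ι ℓ ≃ₐ[ℚ] ringClassField K ι ℓ) × ℕ ↦ q.1 * d.σ ℓ ^ q.2)).filter
            (fun g ↦ g θ = θ),
          pointGalHom W (ringClassField K ι ℓ) g d.y := by
  have hσ := heegner_sigma_apply_theta hK hD hℓ hinert d hθ2 hθ0 hflip
  -- per-coset traces in `2E(K[ℓ])`
  obtain ⟨y₁, -, hsum⟩ := heegner_sum_pow_sigma_eq_frobeniusTrace_zsmul hK hD hH hℓ hinert hℓN d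
  obtain ⟨c, hc⟩ := ha
  have htr : ∀ s ∈ d.S, ∃ w : (W.baseChange (ringClassField K ι ℓ)).toAffine.Point, (2 : ℤ) • w =
      ∑ i ∈ range (ℓ + 1), pointGalHom W (ringClassField K ι ℓ) (s * d.σ ℓ ^ i) d.y := by
    intro s _
    refine ⟨c • pointGalHom W (ringClassField K ι ℓ) s y₁, ?_⟩
    have h1 : ∑ i ∈ range (ℓ + 1), pointGalHom W (ringClassField K ι ℓ) (s * d.σ ℓ ^ i) d.y =
        pointGalHom W (ringClassField K ι ℓ) s (∑ i ∈ range (ℓ + 1), pointGalHom W (ringClassField K ι ℓ) (d.σ ℓ ^ i) d.y) := by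
      rw [map_sum]
      exact Finset.sum_congr rfl fun i _ ↦ by rw [map_mul]; rfl
    rw [h1, hsum, map_zsmul, hc, smul_smul]
  -- `P(ℓ) ≡ odd half ≡ θ-fixed part`
  rw [heegner_exists_two_zsmul_eq_derivedPoint_iff_oddPart, Nat.primeFactorsList_prime hℓ, List.foldr_cons,
    List.foldr_nil]
  obtain ⟨z, hz⟩ := exists_oddHalf_eq_fixPart_add _ (d.σ ℓ) d.S ℓ d.y (fun g ↦ g θ = θ)
    (fun s _ i ↦ heegner_fix_mul_pow_iff d hθ2 hθ0 hσ s i) htr (heegner_injOn_mul_pow hK hD hℓ hinert d)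
  rw [hz]
  have key : ∀ X : (W.baseChange (ringClassField K ι ℓ)).toAffine.Point,
      (∃ Q : (W.baseChange (ringClassField K ι ℓ)).toAffine.Point, (2 : ℤ) • Q = X + (2 : ℤ) • z) ↔
        ∃ Q : (W.baseChange (ringClassField K ι ℓ)).toAffine.Point, (2 : ℤ) • Q = X := fun X ↦
    ⟨fun ⟨Q, hQ⟩ ↦ ⟨Q - z, by rw [smul_sub, hQ, add_sub_cancel_right]⟩, fun ⟨Q, hQ⟩ ↦ ⟨Q + z, by rw [smul_add, hQ]⟩⟩
  rw [key]
  -- the two sides may differ in the `Decidable` instance of the filter (a subsingleton)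
  convert Iff.rfl

/-- **`P(ℓ) ≡ Y_θ = Σ_{g ∈ Gal(K[ℓ]/K), gθ = θ} g·y(ℓ) (mod 2E(K[ℓ]))` — INTRINSIC form.** Same hypotheses; for every
finite set `T` of automorphisms of `K[ℓ]` whose members are exactly the elements of `𝒢_ℓ = Gal(K[ℓ]/K)` fixing `θ`
(e.g. `T = {g ∈ 𝒢_ℓ | gθ = θ}`, the Galois group of `K[ℓ]` over the genus field `K(θ) = K(√ℓ*)`):
`P(ℓ) ∈ 2E(K[ℓ]) ⟺ Σ_{g∈T} g·y(ℓ) ∈ 2E(K[ℓ])`. The right side is the trace of the Heegner point of conductor `ℓ` to the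
genus field — the Heegner datum of the twist pair `(E^{(ℓ*)}, E^{(d_K ℓ*)})` —, independent of `S`, `σ_ℓ`, `D_ℓ`.
[cite: GrossLMS1991, §3 (3.3), (3.5), Prop. 3.7 (1), §4 (4.1)] [cite: SilvermanAEC2009, X.2 Prop. 2.4 (proof)] -/
theorem heegner_exists_two_zsmul_eq_derivedPoint_iff_genusTrace [W.IsElliptic] [W.IsGloballyMinimal]
    (hK : IsImaginaryQuadratic K) (hD : NumberField.discr K < -4)
    (hH : SatisfiesHeegnerHypothesis (W.conductorNorm ℤ) K) {ℓ : ℕ} (hℓ : ℓ.Prime)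
    (hinert : (Ideal.span {(ℓ : 𝓞 K)}).IsPrime) (hℓN : ¬ ℓ ∣ W.conductorNorm ℤ)
    (ha : (2 : ℤ) ∣ W.frobeniusTrace ℓ) (d : KolyvaginHeegnerData Dt β ι ℓ)
    {θ : ringClassField K ι ℓ} {q : ℚ} (hθ2 : θ ^ 2 = algebraMap ℚ (ringClassField K ι ℓ) q) (hθ0 : θ ≠ 0)
    (hflip : ∃ τ ∈ ringClassGalOver ι ℓ 1, τ θ = -θ)
    (T : Finset (ringClassField K ι ℓ ≃ₐ[ℚ] ringClassField K ι ℓ))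
    (hT : ∀ g, g ∈ T ↔ g ∈ ringClassGal ι ℓ ∧ g θ = θ) :
    (∃ Q : (W.baseChange (ringClassField K ι ℓ)).toAffine.Point, (2 : ℤ) • Q = d.derivedPoint) ↔
      ∃ Q : (W.baseChange (ringClassField K ι ℓ)).toAffine.Point, (2 : ℤ) • Q =
        ∑ g ∈ T, pointGalHom W (ringClassField K ι ℓ) g d.y := by
  have hTeq : T = ((d.S ×ˢ range (ℓ + 1)).image
      (fun q : (ringClassField K ι ℓ ≃ₐ[ℚ] ringClassField K ι ℓ) × ℕ ↦ q.1 * d.σ ℓ ^ q.2)).filter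
      (fun g ↦ g θ = θ) := by
    ext g
    rw [hT, Finset.mem_filter, heegner_mem_image_mul_pow_iff hK hD hℓ hinert d]
  rw [hTeq]
  exact heegner_exists_two_zsmul_eq_derivedPoint_iff_fixPart hK hD hH hℓ hinert hℓN ha d hθ2 hθ0 hflip

/-! ### §3 (APPEND 1, same seat) From the named fact `sqrt_pStar_mem_ringClassField` (class field theory of the genus
character) at a Kolyvagin prime at `2` -/

/-- **`P(ℓ) ≡ Tr_{K[ℓ]/K(√ℓ*)} y(ℓ) (mod 2E(K[ℓ]))` at a Kolyvagin prime at `2`, modulo the class-field-theory fact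
`sqrt_pStar_mem_ringClassField`** (Cornut–Vatsal 2007 §1.1 / Cox §8–§9: `√ℓ* ∈ K[ℓ]` and the genus character is
non-trivial on `Gal(K[ℓ]/K[1])`): for `E/ℚ` (globally minimal `W`), `K` imaginary quadratic with the Heegner hypothesis
and `d_K < −4`, and `ℓ` a Kolyvagin prime at `2` (`Zhang2014.IsKolyvaginPrime N_E W K 2 ℓ`: `ℓ ∤ N_E`, `ℓ ∤ d_K`, `ℓ ≠ 2`,
inert, `2 ∣ a_ℓ`), there is `θ ∈ K[ℓ]` with `θ² = ℓ* = (−1)^{(ℓ−1)/2} ℓ`, `θ ≠ 0`, such that for every datum `d` of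
conductor `ℓ` and every finite `T` enumerating `{g ∈ Gal(K[ℓ]/K) : gθ = θ} = Gal(K[ℓ]/K(√ℓ*))`:
`P(ℓ) ∈ 2E(K[ℓ]) ⟺ Σ_{g∈T} g·y(ℓ) ∈ 2E(K[ℓ])`. CONDITIONAL on the named fact only.
[cite: CornutVatsal2007, §1.1 ¶"Ring class characters"] [cite: Cox2013, §8 proof of Thm. 8.12, Thm. 8.10, §9.A]
[cite: GrossLMS1991, §3 (3.3), (3.5), Prop. 3.7 (1), §4 (4.1)] -/
theorem heegner_exists_theta_derivedPoint_iff_genusTrace [W.IsElliptic] [W.IsGloballyMinimal]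
    (hfact : sqrt_pStar_mem_ringClassField) (hK : IsImaginaryQuadratic K) (hD : NumberField.discr K < -4)
    (hH : SatisfiesHeegnerHypothesis (W.conductorNorm ℤ) K) {ℓ : ℕ}
    (hKoly : Zhang2014.IsKolyvaginPrime (W.conductorNorm ℤ) W K 2 ℓ) :
    ∃ θ : ringClassField K ι ℓ,
      θ ^ 2 = algebraMap ℚ (ringClassField K ι ℓ) ((-1 : ℚ) ^ (ℓ / 2) * ℓ) ∧ θ ≠ 0 ∧
      (∃ τ ∈ ringClassGalOver ι ℓ 1, τ θ = -θ) ∧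
      ∀ (d : KolyvaginHeegnerData Dt β ι ℓ) (T : Finset (ringClassField K ι ℓ ≃ₐ[ℚ] ringClassField K ι ℓ)),
        (∀ g, g ∈ T ↔ g ∈ ringClassGal ι ℓ ∧ g θ = θ) →
        ((∃ Q : (W.baseChange (ringClassField K ι ℓ)).toAffine.Point, (2 : ℤ) • Q = d.derivedPoint) ↔
          ∃ Q : (W.baseChange (ringClassField K ι ℓ)).toAffine.Point, (2 : ℤ) • Q =
            ∑ g ∈ T, pointGalHom W (ringClassField K ι ℓ) g d.y) := by
  haveI : Fact (Nat.Prime 2) := ⟨Nat.prime_two⟩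
  have ha : (2 : ℤ) ∣ W.frobeniusTrace ℓ := hKoly.dvd.2
  obtain ⟨hℓ, hℓN, hℓd, hℓ2, hinert, _⟩ := hKoly
  obtain ⟨θ, hθ2, τ, hτ, hτθ⟩ := hfact K hK ι ℓ hℓ hℓ2 hℓd
  have hθ0 : θ ≠ 0 := ne_zero_of_sq_eq_pStar hℓ hθ2
  refine ⟨θ, hθ2, hθ0, ⟨τ, hτ, hτθ⟩, fun d T hT ↦ ?_⟩
  exact heegner_exists_two_zsmul_eq_derivedPoint_iff_genusTrace hK hD hH hℓ hinert hℓN ha d hθ2 hθ0 ⟨τ, hτ, hτθ⟩ T hT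

/-! ### §4 (APPEND 2, same seat) The card's identity as an `iff`: `P(ℓ) ∈ 2E(K[ℓ]) ⟺ a_ℓ·y_K′ − Y_χ ∈ 4E(K[ℓ])`
(UNCONDITIONAL: `E(K[ℓ])[2] = 0` is the U2 track's PROVED `forall_two_nsmul_eq_zero_of_heegner`) -/

omit [NeZero (W.conductorNorm ℤ)] in
/-- **`E(K[n])[2] = 0` on the crux's frames** (Gross's Lemma 4.3 at `p = 2`): for `W` globally minimal with `ρ̄_{E,2}` onto
(so `E(ℚ)[2] = 0`: tree `torsionBy_rat_eq_bot_of_hasIrreducibleModPGaloisRep` ∘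
`hasIrreducibleModPGaloisRep_of_hasSurjectiveModNGaloisRep`), `K` imaginary quadratic with ODD `d_K` (≡ 1 mod 4) and
the Heegner hypothesis: the PROVED theorem `Summit.BirchSwinnertonDyer.Uniform.U2.RingClass.forall_two_nsmul_eq_zero_of_heegner`
of cell «bsd-uniform» (track U2, L1 — (H-Δ) `K ≠ ℚ(√Δ_E)` is automatic there), read in `ℤ`-scalar currency.
[cite: GrossLMS1991, §4, Lemma 4.3] [cite: Cox2013, Lemma 9.3] -/
theorem heegner_two_torsion_free [W.IsElliptic] [W.IsGloballyMinimal] (hK : IsImaginaryQuadratic K)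
    (hodd : Odd (NumberField.discr K)) (hH : SatisfiesHeegnerHypothesis (W.conductorNorm ℤ) K)
    (hsurj : W.HasSurjectiveModNGaloisRep ((2 : ℤ) ^ 1)) {n : ℕ} (hn : n ≠ 0)
    (Q : (W.baseChange (ringClassField K ι n)).toAffine.Point) (hQ : (2 : ℤ) • Q = 0) : Q = 0 := by
  haveI : Fact (Nat.Prime 2) := ⟨Nat.prime_two⟩
  haveI : NeZero ((2 : ℕ) : ℚ) := ⟨by norm_num⟩
  haveI : NumberField (ringClassField K ι n) := numberField_ringClassField hK ι hn
  have hD4 : NumberField.discr K % 4 = 1 := by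
    rcases Literature.NumberTheory.QuadraticFields.Quadratic.isFundamentalDiscriminant_discr (K := K) hK.1 with
      ⟨h1, -, -⟩ | ⟨h4, -, -⟩
    · exact h1
    · exfalso
      obtain ⟨k, hk⟩ := hodd
      omega
  have hirr : W.HasIrreducibleModPGaloisRep 2 :=
    hasIrreducibleModPGaloisRep_of_hasSurjectiveModNGaloisRep W 2 (by simpa using hsurj)
  have hbot := torsionBy_rat_eq_bot_of_hasIrreducibleModPGaloisRep W 2 hirr
  have hT : ∀ P : W.toAffine.Point, 2 • P = 0 → P = 0 := fun P hP ↦ by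
    have hmem : P ∈ AddSubgroup.torsionBy W.toAffine.Point ((2 : ℕ) : ℤ) := AddSubgroup.torsionBy.nsmul_iff.mpr hP
    rw [hbot] at hmem
    exact (AddSubgroup.mem_bot).mp hmem
  refine Summit.BirchSwinnertonDyer.Uniform.U2.RingClass.forall_two_nsmul_eq_zero_of_heegner W hK ι hD4 hH hT hn Q ?_
  rw [← natCast_zsmul]
  exact hQ

/-- **The genus identity of the card as an `iff`, unconditionally** («`2·P(ℓ) ≡ a_ℓ·y_K − Y_χ (mod 4E(K_ℓ))`, hence
«`P(ℓ) ∉ 2E(K[ℓ])` ⟺ `a_ℓ y_K′ − Y_χ ∉ 4E(K[ℓ])`»): for `W` globally minimal with `ρ̄_{E,2}` onto, `K` imaginary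
quadratic with odd `d_K ≠ −3` and the Heegner hypothesis, `ℓ ∤ N_E` a prime inert in `K` with `2 ∣ a_ℓ`, and a datum `d`
of conductor `ℓ`, there is `y₁ ∈ E(K[ℓ])` over `x(1)` (so `y_K′ := Σ_{s∈S} s y₁` is `y_K` read in `E(K[ℓ])`) with
  `P(ℓ) ∈ 2E(K[ℓ]) ⟺ a_ℓ · Σ_{s∈S} s y₁ − Σ_{s∈S} s(Σ_{i≤ℓ} (−1)^i σ_ℓ^i y(ℓ)) ∈ 4E(K[ℓ])`.
(`…GenusIdentity.heegner_exists_two_zsmul_eq_derivedPoint_iff_of_prime` + Gross Prop. 3.7 (1) in `E(K[ℓ])` +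
`heegner_two_torsion_free`.) [cite: GrossLMS1991, §3 (3.5), Prop. 3.7 (1), §4 (4.1), Lemma 4.3] -/
theorem heegner_exists_two_zsmul_eq_derivedPoint_iff_four_dvd [W.IsElliptic] [W.IsGloballyMinimal]
    (hK : IsImaginaryQuadratic K) (hodd : Odd (NumberField.discr K)) (h3 : NumberField.discr K ≠ -3)
    (hH : SatisfiesHeegnerHypothesis (W.conductorNorm ℤ) K) (hsurj : W.HasSurjectiveModNGaloisRep ((2 : ℤ) ^ 1))
    {ℓ : ℕ} (hℓ : ℓ.Prime) (hinert : (Ideal.span {(ℓ : 𝓞 K)}).IsPrime) (hℓN : ¬ ℓ ∣ W.conductorNorm ℤ)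
    (d : KolyvaginHeegnerData Dt β ι ℓ) :
    ∃ y₁ : (W.baseChange (ringClassField K ι ℓ)).toAffine.Point,
      WeierstrassCurve.Affine.Point.map (W' := W) (ringClassField K ι ℓ).subtype.toRatAlgHom y₁ =
        heegnerPointComplexOfConductor Dt (NumberField.discr K) β 1 ∧
      ((∃ Q : (W.baseChange (ringClassField K ι ℓ)).toAffine.Point, (2 : ℤ) • Q = d.derivedPoint) ↔
        ∃ R : (W.baseChange (ringClassField K ι ℓ)).toAffine.Point, (4 : ℤ) • R =
          (W.frobeniusTrace ℓ) • ∑ s ∈ d.S, pointGalHom W (ringClassField K ι ℓ) s y₁ -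
            ∑ s ∈ d.S, pointGalHom W (ringClassField K ι ℓ) s
              (∑ i ∈ range (ℓ + 1), ((-1 : ℤ) ^ i) • pointGalHom W (ringClassField K ι ℓ) (d.σ ℓ ^ i) d.y)) := by
  have hD : NumberField.discr K < -4 := by
    have hneg : NumberField.discr K < 0 := hK.discr_neg
    rcases Literature.NumberTheory.QuadraticFields.Quadratic.isFundamentalDiscriminant_discr (K := K) hK.1 with
      ⟨h1, -, -⟩ | ⟨h4, -, -⟩
    · omega
    · exfalso
      obtain ⟨k, hk⟩ := hodd
      omega
  obtain ⟨y₁, hy₁, hsum⟩ := heegner_sum_pow_sigma_eq_frobeniusTrace_zsmul hK hD hH hℓ hinert hℓN d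
  refine ⟨y₁, hy₁, ?_⟩
  have htors := heegner_two_torsion_free (ι := ι) hK hodd hH hsurj hℓ.ne_zero
  rw [heegner_exists_two_zsmul_eq_derivedPoint_iff_of_prime hℓ d htors]
  have hre : ∑ s ∈ d.S, pointGalHom W (ringClassField K ι ℓ) s
      (∑ i ∈ range (ℓ + 1), pointGalHom W (ringClassField K ι ℓ) (d.σ ℓ ^ i) d.y) =
      (W.frobeniusTrace ℓ) • ∑ s ∈ d.S, pointGalHom W (ringClassField K ι ℓ) s y₁ := by
    rw [hsum, Finset.smul_sum]
    exact Finset.sum_congr rfl fun s _ ↦ map_zsmul _ _ _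
  rw [hre]

/-- **§5 (APPEND 3). `P(ℓ) ≡ Tr_{K[ℓ]/K(√ℓ*)} y(ℓ) (mod 2E(K[ℓ]))` at a Kolyvagin prime at `2`, UNCONDITIONAL**:
§3 fed with the tree THEOREM `sqrt_pStar_mem_ringClassField_holds` (Cox Thm. 9.18) — no named fact remains.
[cite: Cox2013, Thm. 9.18 and §9.A] [cite: GrossLMS1991, §3 (3.3), (3.5), Prop. 3.7 (1), §4 (4.1)] -/
theorem heegner_exists_theta_derivedPoint_iff_genusTrace_holds [W.IsElliptic] [W.IsGloballyMinimal]
    (hK : IsImaginaryQuadratic K) (hD : NumberField.discr K < -4)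
    (hH : SatisfiesHeegnerHypothesis (W.conductorNorm ℤ) K) {ℓ : ℕ}
    (hKoly : Zhang2014.IsKolyvaginPrime (W.conductorNorm ℤ) W K 2 ℓ) :
    ∃ θ : ringClassField K ι ℓ,
      θ ^ 2 = algebraMap ℚ (ringClassField K ι ℓ) ((-1 : ℚ) ^ (ℓ / 2) * ℓ) ∧ θ ≠ 0 ∧
      (∃ τ ∈ ringClassGalOver ι ℓ 1, τ θ = -θ) ∧
      ∀ (d : KolyvaginHeegnerData Dt β ι ℓ) (T : Finset (ringClassField K ι ℓ ≃ₐ[ℚ] ringClassField K ι ℓ)),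
        (∀ g, g ∈ T ↔ g ∈ ringClassGal ι ℓ ∧ g θ = θ) →
        ((∃ Q : (W.baseChange (ringClassField K ι ℓ)).toAffine.Point, (2 : ℤ) • Q = d.derivedPoint) ↔
          ∃ Q : (W.baseChange (ringClassField K ι ℓ)).toAffine.Point, (2 : ℤ) • Q =
            ∑ g ∈ T, pointGalHom W (ringClassField K ι ℓ) g d.y) :=
  heegner_exists_theta_derivedPoint_iff_genusTrace sqrt_pStar_mem_ringClassField_holds hK hD hH hKoly

end Heegner

end Summit.BirchSwinnertonDyer.BirchSwinnertonDyer.Theorems.GenusKoly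

end
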